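import Mathlib

/-!
# LOG-CAPACITY OF A PLANAR ANNULUS (plate t42b, nsreg-p2 g33's spec; ROUND-42 THEOREM B step (B3))

Width piece for crux `EulerZoomLiouville.PowerGaugeEulerLiouville` (stmt-NavierStokesRegularity-19832), by name under
LEAD 19832 (ns-typeII-p2 g12); seat ns-in-ser-c g3 (director-ns inputs-36), `--supports stmt-NavierStokesRegularity-19832
--as helper`.  A self-contained Mathlib lemma — no flow, no profile: the two-dimensional logarithm that makes exits through a
thin planar annulus expensive in Dirichlet energy.

* `annulusEnergy_ge_amplitude` — for `φ ∈ C¹(ℂ, ℝ)`, `0 < w < r`, `φ ≥ A` on the circle `‖z‖ = w` and `φ ≤ B` on `‖z‖ = r`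
  with `B < A`:  `2π (A − B)² / log(r/w) ≤ ∫_{w ≤ ‖z‖ ≤ r} ‖Dφ(z)‖² dz`;
* `two_pi_div_log_le_annulusEnergy` — the normalised case `A = 1`, `B = 0`: `2π / log(r/w) ≤ ∫_{annulus} ‖Dφ‖²`.

ROUTE (nsreg-p2 g33): (S1) along each ray `ρ ↦ ρ e^{iθ}` the fundamental theorem of calculus and `‖∂_ρ(φ∘ray)‖ ≤ ‖Dφ‖`
give `A − B ≤ ∫_w^r ‖Dφ(ρe^{iθ})‖ dρ` (`sub_le_integral_norm_fderiv_ray`); (S2) the weighted Cauchy–Schwarz inequality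
`(∫_w^r a)² ≤ log(r/w) · ∫_w^r ρ a(ρ)²` (`sq_integral_le_log_mul_integral_mul_sq`, from `∫ (ρa − t)²/ρ ≥ 0` and
`∫_w^r ρ⁻¹ = log(r/w)`) gives `(A − B)²/log(r/w) ≤ ∫_w^r ρ‖Dφ(ρe^{iθ})‖² dρ` for every `θ`; (S3) polar coordinates
(`Complex.integral_comp_polarCoord_symm`) and Fubini on `Icc w r ×ˢ Ioo (−π) π` turn the annulus integral into
`∫_{−π}^{π} ∫_w^r ρ‖Dφ‖² dρ dθ ≥ 2π (A − B)²/log(r/w)` (`annulusEnergy_eq_integral_polar`).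

READING (ROUND-42 (B)): with (B1) t42a (`|V(y_t)| ≥ γt` at the exit point) and `|V| ≤ γt/2` off a cap of area `a_t`, the
conformal image of the spherical condenser is such an annulus; the spherical symmetrisation step stays a named-fact candidate.
HONEST FRAMING: plane calculus; proves nothing about the crux E (19832 OPEN), any door Target, or Navier–Stokes regularity;
no summit statement is touched. [folklore (logarithmic capacity of an annulus)]
-/

noncomputable section

open Set Filter Topology Metric Function MeasureTheory intervalIntegral Complex
open scoped Real NNReal ENNReal

set_option linter.dupNamespace false

namespace Summit.NavierStokesRegularity.NavierStokesRegularity.Theorems.PowerGaugeEulerLiouville.Condenser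

/-! ## (S1) Rays: `A − B ≤ ∫_w^r ‖Dφ(ρ e^{iθ})‖ dρ` -/

/-- The unit direction `e^{iθ} = cos θ + i sin θ` has norm one. [folklore] -/
theorem norm_rayDir (θ : ℝ) : ‖((Real.cos θ : ℂ) + (Real.sin θ : ℂ) * I)‖ = 1 := by
  simp

/-- The ray point `ρ e^{iθ}` is `Complex.polarCoord.symm (ρ, θ)` and has norm `|ρ|`. [folklore] -/
theorem norm_ray (ρ θ : ℝ) : ‖((ρ : ℂ) * ((Real.cos θ : ℂ) + (Real.sin θ : ℂ) * I))‖ = |ρ| := by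
  rw [norm_mul, norm_rayDir, mul_one, Complex.norm_real, Real.norm_eq_abs]

/-- Derivative of `φ` along a ray: `d/dρ φ(ρ e^{iθ}) = Dφ(ρ e^{iθ})[e^{iθ}]`. [folklore] -/
theorem hasDerivAt_comp_ray {φ : ℂ → ℝ} (hφ : Differentiable ℝ φ) (θ ρ : ℝ) :
    HasDerivAt (fun ρ : ℝ => φ ((ρ : ℂ) * ((Real.cos θ : ℂ) + (Real.sin θ : ℂ) * I)))
      (fderiv ℝ φ ((ρ : ℂ) * ((Real.cos θ : ℂ) + (Real.sin θ : ℂ) * I))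
        ((Real.cos θ : ℂ) + (Real.sin θ : ℂ) * I)) ρ := by
  have hray : HasDerivAt (fun ρ : ℝ => (ρ : ℂ) * ((Real.cos θ : ℂ) + (Real.sin θ : ℂ) * I))
      ((Real.cos θ : ℂ) + (Real.sin θ : ℂ) * I) ρ := by
    have h := ((hasDerivAt_id ρ).ofReal_comp).mul_const ((Real.cos θ : ℂ) + (Real.sin θ : ℂ) * I)
    simpa using h
  exact (hφ _).hasFDerivAt.comp_hasDerivAt ρ hray

/-- **(S1)** If `φ ≥ A` on the circle `‖z‖ = w` and `φ ≤ B` on `‖z‖ = r` (`0 < w ≤ r`), then along every ray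
`A − B ≤ ∫_w^r ‖Dφ(ρ e^{iθ})‖ dρ` (fundamental theorem of calculus; `‖∂_ρ(φ∘ray)‖ ≤ ‖Dφ‖`). [folklore] -/
theorem sub_le_integral_norm_fderiv_ray {φ : ℂ → ℝ} (hφ : ContDiff ℝ 1 φ) {w r A B : ℝ} (hw : 0 < w) (hwr : w ≤ r)
    (hin : ∀ z : ℂ, ‖z‖ = w → A ≤ φ z) (hout : ∀ z : ℂ, ‖z‖ = r → φ z ≤ B) (θ : ℝ) :
    A - B ≤ ∫ ρ in w..r, ‖fderiv ℝ φ ((ρ : ℂ) * ((Real.cos θ : ℂ) + (Real.sin θ : ℂ) * I))‖ := by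
  set e : ℂ := (Real.cos θ : ℂ) + (Real.sin θ : ℂ) * I with he
  set g : ℝ → ℝ := fun ρ => φ ((ρ : ℂ) * e) with hg
  set g' : ℝ → ℝ := fun ρ => fderiv ℝ φ ((ρ : ℂ) * e) e with hg'
  have hφd : Differentiable ℝ φ := hφ.differentiable one_ne_zero
  have hderiv : ∀ ρ, HasDerivAt g (g' ρ) ρ := fun ρ => hasDerivAt_comp_ray hφd θ ρ
  -- continuity of `g'` and of the norm of the derivative along the ray
  have hrayc : Continuous fun ρ : ℝ => (ρ : ℂ) * e := continuous_ofReal.mul continuous_const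
  have hDc : Continuous fun ρ : ℝ => fderiv ℝ φ ((ρ : ℂ) * e) := (hφ.continuous_fderiv one_ne_zero).comp hrayc
  have hg'c : Continuous g' := hDc.clm_apply continuous_const
  have hNc : Continuous fun ρ : ℝ => ‖fderiv ℝ φ ((ρ : ℂ) * e)‖ := hDc.norm
  -- FTC
  have hftc : ∫ ρ in w..r, g' ρ = g r - g w :=
    integral_eq_sub_of_hasDerivAt (fun ρ _ => hderiv ρ) (hg'c.intervalIntegrable _ _)
  -- boundary values
  have hA : A ≤ g w := hin _ (by rw [he, norm_ray, abs_of_pos hw])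
  have hB : g r ≤ B := hout _ (by rw [he, norm_ray, abs_of_pos (hw.trans_le hwr)])
  -- `|g'| ≤ ‖Dφ‖`
  have hbound : ∀ ρ, |g' ρ| ≤ ‖fderiv ℝ φ ((ρ : ℂ) * e)‖ := by
    intro ρ
    rw [hg', ← Real.norm_eq_abs]
    calc ‖fderiv ℝ φ ((ρ : ℂ) * e) e‖ ≤ ‖fderiv ℝ φ ((ρ : ℂ) * e)‖ * ‖e‖ := ContinuousLinearMap.le_opNorm _ _
      _ = ‖fderiv ℝ φ ((ρ : ℂ) * e)‖ := by rw [he, norm_rayDir, mul_one]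
  have h1 : -(∫ ρ in w..r, g' ρ) ≤ ∫ ρ in w..r, ‖fderiv ℝ φ ((ρ : ℂ) * e)‖ := by
    rw [← intervalIntegral.integral_neg]
    refine intervalIntegral.integral_mono_on hwr (hg'c.neg.intervalIntegrable _ _) (hNc.intervalIntegrable _ _)
      fun ρ _ => ?_
    exact (neg_le_abs _).trans (hbound ρ)
  linarith [hftc, hA, hB, h1]

/-! ## (S2) Weighted Cauchy–Schwarz: `(∫_w^r a)² ≤ log(r/w) · ∫_w^r ρ a²` -/

/-- **(S2)** For a continuous `a` and `0 < w ≤ r`: `(∫_w^r a)² ≤ log(r/w) · ∫_w^r ρ · a(ρ)² dρ`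
(expand `0 ≤ ∫_w^r (ρ a(ρ) − t)²/ρ dρ` with `t = (∫ a)/log(r/w)` and `∫_w^r ρ⁻¹ = log(r/w)`). [folklore] -/
theorem sq_integral_le_log_mul_integral_mul_sq {a : ℝ → ℝ} (ha : Continuous a) {w r : ℝ} (hw : 0 < w) (hwr : w ≤ r) :
    (∫ ρ in w..r, a ρ) ^ 2 ≤ Real.log (r / w) * ∫ ρ in w..r, ρ * a ρ ^ 2 := by
  set C := ∫ ρ in w..r, a ρ with hC
  set E := ∫ ρ in w..r, ρ * a ρ ^ 2 with hE
  set Λ := Real.log (r / w) with hΛ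
  have hr : 0 < r := hw.trans_le hwr
  have hΛ0 : 0 ≤ Λ := Real.log_nonneg ((one_le_div hw).2 hwr)
  have hinv : ∫ ρ in w..r, ρ⁻¹ = Λ := integral_inv_of_pos hw hr
  -- the case `w = r` is trivial
  rcases eq_or_lt_of_le hwr with h | hlt
  · simp [hC, hE, ← h]
  have hΛpos : 0 < Λ := Real.log_pos ((one_lt_div hw).2 hlt)
  -- `0 ≤ ∫ (ρ a − t)² / ρ = E − 2 t C + t² Λ` for every `t`
  have hquad : ∀ t : ℝ, 0 ≤ E - 2 * t * C + t ^ 2 * Λ := by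
    intro t
    have hci : IntervalIntegrable (fun ρ => ρ * a ρ ^ 2) volume w r :=
      ((continuous_id.mul (ha.pow 2)).intervalIntegrable _ _)
    have hai : IntervalIntegrable a volume w r := ha.intervalIntegrable _ _
    have hii : IntervalIntegrable (fun ρ : ℝ => ρ⁻¹) volume w r := by
      refine (continuousOn_inv₀.mono ?_).intervalIntegrable
      intro ρ hρ
      rw [uIcc_of_le hwr] at hρ
      exact ne_of_gt (hw.trans_le hρ.1)
    have hsum : ∫ ρ in w..r, (ρ * a ρ ^ 2 - 2 * t * a ρ + t ^ 2 * ρ⁻¹) = E - 2 * t * C + t ^ 2 * Λ := by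
      rw [intervalIntegral.integral_add (hci.sub (hai.const_mul _)) (hii.const_mul _),
        intervalIntegral.integral_sub hci (hai.const_mul _), intervalIntegral.integral_const_mul,
        intervalIntegral.integral_const_mul, hinv]
    rw [← hsum]
    refine intervalIntegral.integral_nonneg hwr fun ρ hρ => ?_
    have hρ0 : 0 < ρ := hw.trans_le hρ.1
    have hsq : ρ * a ρ ^ 2 - 2 * t * a ρ + t ^ 2 * ρ⁻¹ = (ρ * a ρ - t) ^ 2 / ρ := by
      field_simp
      ring
    rw [hsq]
    positivity
  have h := hquad (C / Λ)
  have hcalc : E - 2 * (C / Λ) * C + (C / Λ) ^ 2 * Λ = E - C ^ 2 / Λ := by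
    field_simp
    ring
  rw [hcalc, sub_nonneg, div_le_iff₀ hΛpos] at h
  linarith [h]

/-- **(S1)+(S2): the radial energy of one ray.**  Under the hypotheses of `sub_le_integral_norm_fderiv_ray` with
`B < A` and `w < r`: `(A − B)²/log(r/w) ≤ ∫_w^r ρ · ‖Dφ(ρ e^{iθ})‖² dρ`. [folklore] -/
theorem sq_div_log_le_rayEnergy {φ : ℂ → ℝ} (hφ : ContDiff ℝ 1 φ) {w r A B : ℝ} (hw : 0 < w) (hwr : w < r)
    (hin : ∀ z : ℂ, ‖z‖ = w → A ≤ φ z) (hout : ∀ z : ℂ, ‖z‖ = r → φ z ≤ B) (hAB : B < A) (θ : ℝ) :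
    (A - B) ^ 2 / Real.log (r / w) ≤
      ∫ ρ in w..r, ρ * ‖fderiv ℝ φ ((ρ : ℂ) * ((Real.cos θ : ℂ) + (Real.sin θ : ℂ) * I))‖ ^ 2 := by
  have hΛpos : 0 < Real.log (r / w) := Real.log_pos ((one_lt_div hw).2 hwr)
  have h1 := sub_le_integral_norm_fderiv_ray hφ hw hwr.le hin hout θ
  have hrayc : Continuous fun ρ : ℝ => (ρ : ℂ) * ((Real.cos θ : ℂ) + (Real.sin θ : ℂ) * I) :=
    continuous_ofReal.mul continuous_const
  have hNc : Continuous fun ρ : ℝ => ‖fderiv ℝ φ ((ρ : ℂ) * ((Real.cos θ : ℂ) + (Real.sin θ : ℂ) * I))‖ :=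
    ((hφ.continuous_fderiv one_ne_zero).comp hrayc).norm
  have h2 := sq_integral_le_log_mul_integral_mul_sq hNc hw hwr.le
  rw [div_le_iff₀ hΛpos]
  have h3 : (A - B) ^ 2 ≤ (∫ ρ in w..r,
      ‖fderiv ℝ φ ((ρ : ℂ) * ((Real.cos θ : ℂ) + (Real.sin θ : ℂ) * I))‖) ^ 2 :=
    pow_le_pow_left₀ (by linarith) h1 2
  linarith [h2, h3]

/-! ## (S3) Polar coordinates: the annulus energy as an iterated integral -/

/-- **(S3) The annulus energy in polar coordinates.**  For a continuous `F : ℂ → ℝ` and `0 < w ≤ r`: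
`∫_{w ≤ ‖z‖ ≤ r} F = ∫_{θ ∈ (−π, π)} ∫_w^r ρ · F(ρ e^{iθ}) dρ dθ`
(`Complex.integral_comp_polarCoord_symm` + Fubini on `Icc w r ×ˢ Ioo (−π) π`). [folklore] -/
theorem annulusIntegral_eq_integral_polar {F : ℂ → ℝ} (hF : Continuous F) {w r : ℝ} (hw : 0 < w) (hwr : w ≤ r) :
    ∫ z in {z : ℂ | w ≤ ‖z‖ ∧ ‖z‖ ≤ r}, F z =
      ∫ θ in Ioo (-π) π, ∫ ρ in w..r, ρ * F ((ρ : ℂ) * ((Real.cos θ : ℂ) + (Real.sin θ : ℂ) * I)) := by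
  set S : Set ℂ := {z : ℂ | w ≤ ‖z‖ ∧ ‖z‖ ≤ r} with hSdef
  have hSm : MeasurableSet S :=
    (isClosed_le continuous_const continuous_norm).measurableSet.inter
      (isClosed_le continuous_norm continuous_const).measurableSet
  -- the integrand in polar coordinates
  set G : ℝ × ℝ → ℝ := fun p => p.1 * F (Complex.polarCoord.symm p) with hGdef
  have hGeq : G = fun p : ℝ × ℝ => p.1 * F ((p.1 : ℂ) * ((Real.cos p.2 : ℂ) + (Real.sin p.2 : ℂ) * I)) := by
    funext p; simp only [hGdef, Complex.polarCoord_symm_apply]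
  have hsymmc : Continuous fun p : ℝ × ℝ => (p.1 : ℂ) * ((Real.cos p.2 : ℂ) + (Real.sin p.2 : ℂ) * I) := by
    fun_prop
  have hGc : Continuous G := by
    rw [hGeq]; exact continuous_fst.mul (hF.comp hsymmc)
  set T : Set (ℝ × ℝ) := Icc w r ×ˢ (univ : Set ℝ) with hTdef
  have hTm : MeasurableSet T := measurableSet_Icc.prod MeasurableSet.univ
  -- (a)+(b) polar coordinates
  have h1 : ∫ z in S, F z = ∫ p in polarCoord.target, p.1 • (S.indicator F) (Complex.polarCoord.symm p) := by
    rw [← MeasureTheory.integral_indicator hSm, ← Complex.integral_comp_polarCoord_symm]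
  -- (c) on the target the integrand is the indicator of `T` times `G`
  have htarget : polarCoord.target = Ioi (0 : ℝ) ×ˢ Ioo (-π) π := rfl
  have h2 : ∫ p in polarCoord.target, p.1 • (S.indicator F) (Complex.polarCoord.symm p) =
      ∫ p in polarCoord.target, T.indicator G p := by
    refine setIntegral_congr_fun polarCoord.open_target.measurableSet fun p hp => ?_
    rw [htarget] at hp
    have hp1 : 0 < p.1 := hp.1
    have hnorm : ‖Complex.polarCoord.symm p‖ = p.1 := by
      rw [Complex.norm_polarCoord_symm, abs_of_pos hp1]
    by_cases hmem : p.1 ∈ Icc w r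
    · have hS : Complex.polarCoord.symm p ∈ S := by
        rw [hSdef, mem_setOf_eq, hnorm]; exact hmem
      have hT : p ∈ T := ⟨hmem, mem_univ _⟩
      rw [indicator_of_mem hS, indicator_of_mem hT, smul_eq_mul]
    · have hS : Complex.polarCoord.symm p ∉ S := by
        rw [hSdef, mem_setOf_eq, hnorm]; exact hmem
      have hT : p ∉ T := fun h => hmem h.1
      rw [indicator_of_notMem hS, indicator_of_notMem hT, smul_zero]
  -- (d)+(e) restrict to `Icc w r ×ˢ Ioo (−π) π`
  have hset : polarCoord.target ∩ T = Icc w r ×ˢ Ioo (-π) π := by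
    rw [htarget, hTdef]
    ext p
    simp only [mem_inter_iff, mem_prod, mem_Ioi, mem_Ioo, mem_Icc, mem_univ, and_true]
    constructor
    · rintro ⟨⟨_, hθ⟩, hρ⟩; exact ⟨hρ, hθ⟩
    · rintro ⟨hρ, hθ⟩; exact ⟨⟨hw.trans_le hρ.1, hθ⟩, hρ⟩
  have h3 : ∫ p in polarCoord.target, T.indicator G p = ∫ p in Icc w r ×ˢ Ioo (-π) π, G p := by
    rw [setIntegral_indicator hTm, hset]
  -- (f) Fubini, `θ` outside
  have hGi : IntegrableOn G (Icc w r ×ˢ Ioo (-π) π) (volume.prod volume) :=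
    (hGc.continuousOn.integrableOn_compact (isCompact_Icc.prod isCompact_Icc)).mono_set
      (prod_mono le_rfl Ioo_subset_Icc_self)
  have h4 : ∫ p in Icc w r ×ˢ Ioo (-π) π, G p = ∫ θ in Ioo (-π) π, ∫ ρ in Icc w r, G (ρ, θ) := by
    have h := integral_prod_symm G (μ := volume.restrict (Icc w r)) (ν := volume.restrict (Ioo (-π) π))
      (by rw [Measure.prod_restrict]; exact hGi)
    rw [Measure.prod_restrict] at h
    exact h
  -- (g) the inner integral as an interval integral along the ray
  have h5 : ∀ θ, ∫ ρ in Icc w r, G (ρ, θ) =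
      ∫ ρ in w..r, ρ * F ((ρ : ℂ) * ((Real.cos θ : ℂ) + (Real.sin θ : ℂ) * I)) := by
    intro θ
    rw [intervalIntegral.integral_of_le hwr, integral_Icc_eq_integral_Ioc]
    refine setIntegral_congr_fun measurableSet_Ioc fun ρ _ => ?_
    simp only [hGdef, Complex.polarCoord_symm_apply]
  rw [h1, h2, h3, h4]
  exact setIntegral_congr_fun measurableSet_Ioo fun θ _ => h5 θ

/-! ## The capacity inequality -/

/-- **LOG-CAPACITY OF A PLANAR ANNULUS (amplitude form).**  For `φ ∈ C¹(ℂ, ℝ)`, `0 < w < r`, `A ≤ φ` on the circle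
`‖z‖ = w`, `φ ≤ B` on `‖z‖ = r` and `B < A`:
`2π (A − B)² / log(r/w) ≤ ∫_{w ≤ ‖z‖ ≤ r} ‖Dφ(z)‖² dz`. [folklore (logarithmic capacity of an annulus)] -/
theorem annulusEnergy_ge_amplitude {φ : ℂ → ℝ} (hφ : ContDiff ℝ 1 φ) {w r A B : ℝ} (hw : 0 < w) (hwr : w < r)
    (hin : ∀ z : ℂ, ‖z‖ = w → A ≤ φ z) (hout : ∀ z : ℂ, ‖z‖ = r → φ z ≤ B) (hAB : B < A) :
    2 * π * (A - B) ^ 2 / Real.log (r / w) ≤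
      ∫ z in {z : ℂ | w ≤ ‖z‖ ∧ ‖z‖ ≤ r}, ‖fderiv ℝ φ z‖ ^ 2 := by
  have hFc : Continuous fun z => ‖fderiv ℝ φ z‖ ^ 2 := (hφ.continuous_fderiv one_ne_zero).norm.pow 2
  rw [annulusIntegral_eq_integral_polar hFc hw hwr.le]
  -- the ray energies, as a continuous function of `θ`
  set h : ℝ → ℝ := fun θ => ∫ ρ in w..r,
    ρ * ‖fderiv ℝ φ ((ρ : ℂ) * ((Real.cos θ : ℂ) + (Real.sin θ : ℂ) * I))‖ ^ 2 with hh
  have hray2 : Continuous fun p : ℝ × ℝ => (p.2 : ℂ) * ((Real.cos p.1 : ℂ) + (Real.sin p.1 : ℂ) * I) := by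
    fun_prop
  have hhc : Continuous h := by
    refine intervalIntegral.continuous_parametric_intervalIntegral_of_continuous' ?_ w r
    exact continuous_snd.mul (hFc.comp hray2)
  have hlow : ∀ θ, (A - B) ^ 2 / Real.log (r / w) ≤ h θ := fun θ =>
    sq_div_log_le_rayEnergy hφ hw hwr hin hout hAB θ
  have hconst : ∫ θ in Ioo (-π) π, (A - B) ^ 2 / Real.log (r / w) = 2 * π * (A - B) ^ 2 / Real.log (r / w) := by
    rw [setIntegral_const, measureReal_def, Real.volume_Ioo,
      ENNReal.toReal_ofReal (by linarith [Real.pi_pos]), smul_eq_mul]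
    ring
  rw [← hconst]
  refine setIntegral_mono_on ?_ (hhc.integrableOn_Icc.mono_set Ioo_subset_Icc_self) measurableSet_Ioo
    fun θ _ => hlow θ
  exact (continuous_const.integrableOn_Icc (a := -π) (b := π)).mono_set Ioo_subset_Icc_self

/-- **LOG-CAPACITY OF A PLANAR ANNULUS.**  For `φ ∈ C¹(ℂ, ℝ)`, `0 < w < r`, `φ ≥ 1` on the circle `‖z‖ = w` and
`φ ≤ 0` on `‖z‖ = r`:  `2π / log(r/w) ≤ ∫_{w ≤ ‖z‖ ≤ r} ‖Dφ(z)‖² dz` — the two-dimensional logarithm that makes exits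
through a thin annulus exponentially expensive (ROUND-42 (B3)). [folklore (logarithmic capacity of an annulus)] -/
theorem two_pi_div_log_le_annulusEnergy {φ : ℂ → ℝ} (hφ : ContDiff ℝ 1 φ) {w r : ℝ} (hw : 0 < w) (hwr : w < r)
    (hin : ∀ z : ℂ, ‖z‖ = w → 1 ≤ φ z) (hout : ∀ z : ℂ, ‖z‖ = r → φ z ≤ 0) :
    2 * π / Real.log (r / w) ≤ ∫ z in {z : ℂ | w ≤ ‖z‖ ∧ ‖z‖ ≤ r}, ‖fderiv ℝ φ z‖ ^ 2 := by
  have h := annulusEnergy_ge_amplitude hφ hw hwr hin hout zero_lt_one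
  simpa using h

end Summit.NavierStokesRegularity.NavierStokesRegularity.Theorems.PowerGaugeEulerLiouville.Condenser

end
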